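import Summits.BirchSwinnertonDyer.BirchSwinnertonDyer.Theorems.CumulativeHeegnerLeopoldtCumulativeHeegnerInclusionAtThreeB1OfPrint
import Summits.BirchSwinnertonDyer.BirchSwinnertonDyer.Theorems.CumulativeHeegnerLeopoldtCumulativeHeegnerInclusionAtThreeLineDeterminantAtThree
import Summits.BirchSwinnertonDyer.BirchSwinnertonDyer.Theorems.CumulativeHeegnerLeopoldtCumulativeHeegnerInclusionAtThreeBadPlacesSplitFinite
import Summits.BirchSwinnertonDyer.BirchSwinnertonDyer.Theorems.CumulativeHeegnerLeopoldtEisensteinCharacterInvariantsAtThreeAlgebraicHalfOfResidualFinite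
import HarnessLib

/-!
# Route `CumulativeHeegnerLeopoldt`, crux K2 `EisensteinCharacterInvariantsAtThree` (stmt-BirchSwinnertonDyer-24199),
# line `birth`: STUB A `stub_algebraicLambdaMuZero` MODULO THE ROUTE'S PRINT ITEM (helper, `--supports 24199`)

Lead prover `bsd-line-chl-p1` g9. The registered stub A of the K2 line `birth` (skeleton 7ff6adfe04f0; «at every BDP
frame of the Leopoldt cell, `Ch_Λ(X_{∅,0}(𝔭′))·R₀⟦T⟧ = (g)` with `‖g_i‖ < 1 (i < n)`, `‖g_n‖ = 1` for some `g, n`»,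
i.e. the characteristic ideal is principal after base change to `R₀⟦T⟧` with `μ_alg = 0` and a well-defined
`λ_alg = n`) is NOT research content any more: it follows from

* the route's PRINT support item stmt-BirchSwinnertonDyer-26897 `ResidualSelmerPrintedInputAtThree` BY NAME
  (= the Literature named fact `CastellaGrossiLeeSkinner2022.prop14_residualCharacterSelmer_finite`, Castella–Grossi–
  Lee–Skinner, Invent. Math. 227 (2022) §1.2 Prop. 14: the residual Greenberg Selmer group of a non-anomalous
  character over `K_∞^{ac}` is finite — an unproved published input, DISPLAYED as the hypothesis `hP`; this theorem is
  therefore CONDITIONAL on it and closes nothing by itself);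
* the CLOSED support item stmt-BirchSwinnertonDyer-26898 `ResidualSelmerFiniteAtThreeOfPrint` (K1 lineage, p616187:
  `cumulativeHeegnerLeopoldt_residualSelmerFiniteAtThreeOfPrint_proof`, print ⟹ B1 = «`Sel_{𝔭′}(K_∞, E[3^∞])[3]`
  finite on the cell»);
* the g7 helper p609299 `EisensteinCharacterInvariantsAtThreeAlgebraicHalf.stub_algebraicLambdaMuZero_of_stub_residualSelmerFinite`
  (B1 VERBATIM ⟹ stub A VERBATIM: Greenberg's criterion on the constructed dual + Weierstrass preparation / norm profile).

So the K2 line's open content is stub B `stub_analyticMuZero` (μ(ℒ_𝔭^{BDP}) = 0 at wild additive 3) and stub C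
`stub_lambdaComparison` (λ_alg = λ_an), both cut through the two characters of `E[3]^{ss}` (p614352 and this seat's
reshape). THEOREMS ONLY; no `def`, no `sorry`; standard axioms. BSD is not proved for any curve by any of this.
-/

set_option autoImplicit false
set_option linter.dupNamespace false

noncomputable section

open scoped Classical

namespace Summit.BirchSwinnertonDyer.BirchSwinnertonDyer.Theorems.EisensteinCharacterInvariantsAtThreeAlgebraicHalf

/-- **Stub A of the K2 line `birth` modulo print.** Hypothesis `hP` = the route's print item
`ResidualSelmerPrintedInputAtThree` (stmt-26897) BY NAME, i.e. the Literature named fact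
`CastellaGrossiLeeSkinner2022.prop14_residualCharacterSelmer_finite` (CGLS 2022 Prop. 14; unproved published input —
this theorem is CONDITIONAL on it). Conclusion = the registered stub `stub_algebraicLambdaMuZero` VERBATIM: at every
BDP frame of the Leopoldt cell, `Ch_Λ(X_{∅,0}(𝔭′))` mapped to `R₀⟦T⟧` is `(g)` for a `g` with no unit coefficient
below some `n` and a unit coefficient at `n` (`μ_alg = 0`, `λ_alg = n`). Proof: print ⟹ B1 (closed item 26898,
p616187 — used here through its route-independent parts `stub_residualSelmerFinite_of_print`,
`stub_lineDeterminantAtThree`, `stub_badPlacesSplitFinite`, so that this file does not import the route file) ⟹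
stub A (p609299). `hP` is definitionally the route item `ResidualSelmerPrintedInputAtThree`. -/
theorem stub_algebraicLambdaMuZero_of_print
    (hP : Literature.NumberTheory.EllipticCurves.CastellaGrossiLeeSkinner2022.prop14_residualCharacterSelmer_finite) :
    ∀ (W : WeierstrassCurve ℚ) [W.IsElliptic] [W.IsGloballyMinimal] (N : ℕ) [NeZero N] (K : Type) [Field K] [NumberField K] (Dt : Literature.NumberTheory.EllipticCurves.ModularForms.ModularParametrizationData W N), Summit.BirchSwinnertonDyer.Rank1Residual.Additive.ClassO6 W 3 → Literature.NumberTheory.EllipticCurves.Rank1Residual.Red W 3 → (∃ Φ : AddSubgroup (WeierstrassCurve.geomTorsion W ((3 : ℕ) : ℤ)), Literature.NumberTheory.EllipticCurves.Rank1Residual.IsRationalLine W 3 Φ ∧ ∀ (v : IsDedekindDomain.HeightOneSpectrum (NumberField.RingOfIntegers ℚ)), ((3 : ℕ) : NumberField.RingOfIntegers ℚ) ∈ v.asIdeal → ∀ 𝔓 ∈ v.primesAbove, ¬ (∀ g ∈ 𝔓.decompositionSubgroup (Field.absoluteGaloisGroup ℚ), ∀ P ∈ Φ, g • P = P) ∧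 ¬ (∀ g ∈ 𝔓.decompositionSubgroup (Field.absoluteGaloisGroup ℚ), ∀ P : WeierstrassCurve.geomTorsion W ((3 : ℕ) : ℤ), g • P - P ∈ Φ)) → W.analyticRank = 1 → W.conductorNorm ℤ = N → Literature.NumberTheory.EllipticCurves.IsImaginaryQuadratic K → Literature.NumberTheory.EllipticCurves.SatisfiesHeegnerHypothesis N K → ∀ (κ : Literature.NumberTheory.EllipticCurves.ZpExtension K 3), κ.IsAnticyclotomic → ∀ (γ : Field.absoluteGaloisGroup K) [Fact (κ.IsTopGenerator γ)] (𝔭 : IsDedekindDomain.HeightOneSpectrum (NumberField.RingOfIntegers K)), ((3 : ℕ) : NumberField.RingOfIntegers K) ∈ 𝔭.asIdeal → 𝔭.asIdeal.ramificationIdx (NumberField.RingOfIntegers ℚ) = 1 → 𝔭.asIdeal.inertiaDeg (NumberField.RingOfIntegers ℚ) = 1 → ∀ (𝔭' : IsDedekindDomain.HeightOneSpectrum (NumberField.RingOfIntegers K)), ((3 : ℕ) : NumberField.RingOfIntegers K) ∈ 𝔭'.asIdeal → 𝔭' ≠ 𝔭 → ∀ (ι' : PadicAlgCl 3 ≃+*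 ℂ), Summit.BirchSwinnertonDyer.BirchSwinnertonDyer.Theorems.SchneiderFree.BranchInducesPrime 3 ι' 𝔭 → ∀ (ΩK : ℂ) (Ωp : ℂ_[3]) (L : Literature.NumberTheory.EllipticCurves.UnrSeries 3), ΩK ≠ 0 → Ωp ≠ 0 → Literature.NumberTheory.EllipticCurves.IsBDPLFunction ι' 𝔭 κ γ Dt.f ΩK Ωp L → ∃ (g : Literature.NumberTheory.EllipticCurves.UnrSeries 3) (n : ℕ), (Summit.BirchSwinnertonDyer.Rank1Residual.X11b.AcSelmer.XAc.charIdeal (W.baseChange K) 3 κ 𝔭' ∅ γ).map (PowerSeries.map (Summit.BirchSwinnertonDyer.Rank1Residual.X11b.Halves.toUnr 3)) = Ideal.span {g} ∧ (∀ i < n, ‖((PowerSeries.coeff i g : Literature.NumberTheory.EllipticCurves.unrIntegers 3) : ℂ_[3])‖ < 1) ∧ ‖((PowerSeries.coeff n g : Literature.NumberTheory.EllipticCurves.unrIntegers 3) : ℂ_[3])‖ = 1 :=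
  stub_algebraicLambdaMuZero_of_stub_residualSelmerFinite
    (Summit.BirchSwinnertonDyer.BirchSwinnertonDyer.Theorems.CumulativeHeegnerInclusionAtThreeB1OfPrint.stub_residualSelmerFinite_of_print
      hP
      Summit.BirchSwinnertonDyer.BirchSwinnertonDyer.Theorems.CumulativeHeegnerInclusionAtThreeLineDet.stub_lineDeterminantAtThree
      Summit.BirchSwinnertonDyer.BirchSwinnertonDyer.Theorems.CumulativeHeegnerInclusionAtThreeBadPlaces.stub_badPlacesSplitFinite)

end Summit.BirchSwinnertonDyer.BirchSwinnertonDyer.Theorems.EisensteinCharacterInvariantsAtThreeAlgebraicHalf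

end
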